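import Mathlib.NumberTheory.LSeries.Dirichlet
import Mathlib.Analysis.SpecialFunctions.SmoothTransition
import Mathlib.MeasureTheory.Integral.IntervalIntegral.FundThmCalculus
import HarnessLib

/-!
# Half-isolated zeros of `ζ` and short zero-detecting prime sums (Maynard–Pratt 2024)

Topic `Literature/NumberTheory/LFunctions`. Definitions (all with bodies) and ONE named fact from

* J. Maynard, K. Pratt, *Half-isolated zeros and zero-density estimates*, Int. Math. Res. Not.
  IMRN 2024:19, 12978–13014, doi:10.1093/imrn/rnae191 = arXiv:2206.11729 (`MaynardPratt2024`).
  Statement numbers and pages below are those of the arXiv text.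

## Contents

* `YHalfIsolatedZero Y ρ` — **Definition 8** (p. 8). Given `Y > 1`, a zero `ρ = β₀ + iγ₀` of `ζ`
  is `Y`-half-isolated if every zero `ρ' = β' + iγ'` of `ζ` with `|ρ' − ρ| ≤ (log |γ₀|)²`
  satisfies (`|β' − β₀| ≤ 1/(10 log Y)` and `γ' ≥ γ₀`) or `β' ≤ β₀ − (log log |γ₀|)² / log Y`.
* `HalfIsolatedZero ρ` — **Definition 9** (p. 8): `Y`-half-isolated for some `Y` with
  `(log log |γ₀|)³ ≤ log Y ≤ log |γ₀| / log log |γ₀|`.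
* `smoothedVonMangoldt w U s = Σ_n Λ(n) w(n/U) n^{-s}` — the zero-detecting polynomial `S_U(s)`
  of §2.1 (p. 5) and of Proposition 16 (p. 10), for an arbitrary weight `w : ℝ → ℝ`.
* `MaynardPratt.w0Core`, `MaynardPratt.w0Const`, `MaynardPratt.w0Step`, `MaynardPratt.w0` — the
  functions `h`, `C = ∫₀¹ h`, `H = C⁻¹ ∫_{-∞}^y h` and the dyadic partition-of-unity weight
  `w₀(x) = H(2x − 1) − H(x − 1)` of **Lemma 43** (p. 25), with the elementary half of Lemma 43
  PROVED: `w₀ ∈ C^∞`, `0 ≤ w₀ ≤ 1`, `support w₀ ⊆ [1/2, 2]`, `w₀(1) = 1`, and the dyadic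
  partition of unity `Σ_{m ≥ 0} w₀(x/2^m) = 1` for `x ≥ 1`.
* `MaynardPratt2024_prop16` — NAMED FACT (not proved here): **Proposition 16** (p. 10), the
  short zero-detecting polynomial for `Y`-half-isolated zeros, together with the PROVED
  corollary `MaynardPratt2024_prop16.detection` in the `(log T)^{-C}` currency.
* `MaynardPratt2024_prop16.theorem4` — **Theorem 4** (p. 4: half-isolated zeros in the sense of
  Definition 9 have zero-detecting polynomials of length in `[T^{(log log T)³/log T}, T^{5/log log T}]`),
  PROVED from the named fact by the one-line reduction printed on p. 11.

## Design choices

* In Lean `Real.log |x| = Real.log x` (`Real.log_abs`), so the predicates are written with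
  `Real.log ρ.im`; the printed `log |γ₀|` form is `yHalfIsolatedZero_iff_abs`.
* Definition 8 is stated in the paper for a real `Y > 1`; we make `1 < Y` a field of the
  structure, and `riemannZeta ρ = 0` as well ("we call a zero `ρ₀` of `ζ(s)` …").
  For `Y ≤ 1` or `ρ.im ≤ 1` the source defines nothing; the Lean predicates then say whatever the
  formulas say (`Real.log` of a nonpositive number is a junk value) and no statement here uses
  that range.
* `smoothedVonMangoldt` is a `tsum`; for compactly supported `w` (the only case used) it is a
  finite sum (`smoothedVonMangoldt_eq_sum`) and an `LSeries` (`smoothedVonMangoldt_eq_LSeries`).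
* The named fact is Proposition 16 with two deviations, both making it WEAKER than the printed
  statement (so the printed statement implies it): the hypothesis `1/2 ≤ Re ρ₀`, which the first
  line of the printed proof assumes (p. 10: "with `γ₀ ∈ [T,2T]` and `β₀ ≥ 1/2`"), and the range
  `log Y ≤ (log T)/2` in place of the printed `log Y ≤ log T`; see the docstring of
  `MaynardPratt2024_prop16` for the reason (numbers). All applications in the paper (Theorem 4,
  i.e. half-isolated zeros in the sense of Definition 9: `log Y ≤ log |γ₀| / log log |γ₀|`;
  Lemma 35: `Y = A^{1/2} ≤ T^{1/2}`) lie in the vendored range.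

## What is NOT here

The analytic half of Lemma 43 (the derivative bounds `|w₀^{(j)}| ≪ (4j²/e²)^j`, `W₀(0) = log 2`,
the Mellin decay `|W₀(σ+it)| ≪ 2^{|σ|}e^{-√(|t|/2)}`),
Lemmas 10, 11 (the refined power-sum estimate: named fact `MaynardPratt2024_lemma11` in
`Literature/Analysis/Complex/MaynardPrattPowerSum.lean`, with Lemma 7 derived there), 15,
Corollary 5 (no proof is printed: "immediate" from Theorem 4 and large-values estimates), and the
proof of Proposition 16 (smoothed
explicit formula, cf. `Literature/NumberTheory/LFunctions/SmoothedExplicitFormula*.lean` for the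
prime side in the `f(log n)` parametrisation, `w(n/U) = f(log n)` with `f(x) = w(eˣ/U)`).
-/

noncomputable section

open Complex Real MeasureTheory Set Filter ArithmeticFunction
open scoped Topology

namespace Literature.NumberTheory.LFunctions

/-! ## Definitions 8 and 9: half-isolated zeros -/

/-- **`Y`-half-isolated zero of `ζ`** (Maynard–Pratt, Definition 8, p. 8 of arXiv:2206.11729).
Given a real `Y > 1`, a zero `ρ = β₀ + iγ₀` of the Riemann zeta function is *`Y`-half-isolated* if
every zero `ρ' = β' + iγ'` of `ζ` with `|ρ' − ρ| ≤ (log |γ₀|)²` satisfies at least one of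
* (similar real part and larger imaginary part) `|β' − β₀| ≤ 1/(10 log Y)` and `γ' ≥ γ₀`;
* (smaller real part) `β' ≤ β₀ − (log log |γ₀|)² / log Y`.

Here `Real.log ρ.im = Real.log |ρ.im|` (`Real.log_abs`), see `yHalfIsolatedZero_iff_abs` for the
printed form. "Zero of `ζ`" is `riemannZeta ρ' = 0` (all zeros; for `|γ₀|` large only nontrivial
zeros are within `(log |γ₀|)²` of `ρ`). [cite: MaynardPratt2024, Definition 8] -/
structure YHalfIsolatedZero (Y : ℝ) (ρ : ℂ) : Prop where
  /-- The parameter satisfies `Y > 1` (standing assumption of Definition 8). -/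
  one_lt : 1 < Y
  /-- `ρ` is a zero of the Riemann zeta function. -/
  zero : riemannZeta ρ = 0
  /-- Every zero within `(log |γ₀|)²` of `ρ` is nearly on the same vertical line and above `ρ`,
  or well to the left of `ρ`. -/
  near : ∀ ρ' : ℂ, riemannZeta ρ' = 0 → ‖ρ' - ρ‖ ≤ Real.log ρ.im ^ 2 →
    (|ρ'.re - ρ.re| ≤ 1 / (10 * Real.log Y) ∧ ρ.im ≤ ρ'.im) ∨
      ρ'.re ≤ ρ.re - Real.log (Real.log ρ.im) ^ 2 / Real.log Y

/-- **Half-isolated zero of `ζ`** (Maynard–Pratt, Definition 9, p. 8 of arXiv:2206.11729):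
`ρ = β₀ + iγ₀` is *half-isolated* if it is `Y`-half-isolated for some `Y` with
`(log log |γ₀|)³ ≤ log Y ≤ log |γ₀| / log log |γ₀|`. [cite: MaynardPratt2024, Definition 9] -/
def HalfIsolatedZero (ρ : ℂ) : Prop :=
  ∃ Y : ℝ, Real.log (Real.log ρ.im) ^ 3 ≤ Real.log Y ∧
    Real.log Y ≤ Real.log ρ.im / Real.log (Real.log ρ.im) ∧ YHalfIsolatedZero Y ρ

/-- Unfolding of `YHalfIsolatedZero` as a conjunction. [cite: MaynardPratt2024, Definition 8] -/
theorem yHalfIsolatedZero_iff (Y : ℝ) (ρ : ℂ) :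
    YHalfIsolatedZero Y ρ ↔ 1 < Y ∧ riemannZeta ρ = 0 ∧
      ∀ ρ' : ℂ, riemannZeta ρ' = 0 → ‖ρ' - ρ‖ ≤ Real.log ρ.im ^ 2 →
        (|ρ'.re - ρ.re| ≤ 1 / (10 * Real.log Y) ∧ ρ.im ≤ ρ'.im) ∨
          ρ'.re ≤ ρ.re - Real.log (Real.log ρ.im) ^ 2 / Real.log Y :=
  ⟨fun h ↦ ⟨h.one_lt, h.zero, h.near⟩, fun h ↦ ⟨h.1, h.2.1, h.2.2⟩⟩

/-- `YHalfIsolatedZero` in the printed form, with `log |γ₀|` (`Real.log |x| = Real.log x`).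
[cite: MaynardPratt2024, Definition 8] -/
theorem yHalfIsolatedZero_iff_abs (Y : ℝ) (ρ : ℂ) :
    YHalfIsolatedZero Y ρ ↔ 1 < Y ∧ riemannZeta ρ = 0 ∧
      ∀ ρ' : ℂ, riemannZeta ρ' = 0 → ‖ρ' - ρ‖ ≤ Real.log |ρ.im| ^ 2 →
        (|ρ'.re - ρ.re| ≤ 1 / (10 * Real.log Y) ∧ ρ.im ≤ ρ'.im) ∨
          ρ'.re ≤ ρ.re - Real.log (Real.log |ρ.im|) ^ 2 / Real.log Y := by
  rw [Real.log_abs]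
  exact yHalfIsolatedZero_iff Y ρ

/-- `ρ` itself always satisfies the first alternative of Definition 8 (for `Y > 1`): the
condition is only about the OTHER zeros. [folklore] -/
theorem YHalfIsolatedZero.self_alternative {Y : ℝ} (hY : 1 < Y) (ρ : ℂ) :
    |ρ.re - ρ.re| ≤ 1 / (10 * Real.log Y) ∧ ρ.im ≤ ρ.im := by
  refine ⟨?_, le_rfl⟩
  rw [sub_self, abs_zero]
  exact div_nonneg zero_le_one (mul_nonneg (by norm_num) (Real.log_nonneg hY.le))

/-- The form in which Definition 8 is USED (proof of Proposition 16, p. 10): if `ρ` is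
`Y`-half-isolated and `e ≤ T ≤ Im ρ`, then every zero `ρ'` with `|ρ' − ρ| ≤ (log T)²` satisfies
`|Re ρ' − Re ρ| ≤ 1/(10 log Y) ∧ Im ρ ≤ Im ρ'` or `Re ρ' ≤ Re ρ − (log log T)²/log Y`
(the window shrinks and the offset weakens monotonically in `T ≤ Im ρ`).
[cite: MaynardPratt2024, Proposition 16 (proof)] -/
theorem YHalfIsolatedZero.near_of_le_im {Y T : ℝ} {ρ : ℂ} (h : YHalfIsolatedZero Y ρ)
    (hT : Real.exp 1 ≤ T) (hTρ : T ≤ ρ.im) {ρ' : ℂ} (hζ : riemannZeta ρ' = 0)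
    (hd : ‖ρ' - ρ‖ ≤ Real.log T ^ 2) :
    (|ρ'.re - ρ.re| ≤ 1 / (10 * Real.log Y) ∧ ρ.im ≤ ρ'.im) ∨
      ρ'.re ≤ ρ.re - Real.log (Real.log T) ^ 2 / Real.log Y := by
  have hTpos : 0 < T := (Real.exp_pos 1).trans_le hT
  have hlogT : 1 ≤ Real.log T := by rwa [Real.le_log_iff_exp_le hTpos]
  have hlog_le : Real.log T ≤ Real.log ρ.im := Real.log_le_log hTpos hTρ
  have hloglog_le : Real.log (Real.log T) ≤ Real.log (Real.log ρ.im) :=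
    Real.log_le_log (by linarith) hlog_le
  have hloglog_nn : 0 ≤ Real.log (Real.log T) := Real.log_nonneg hlogT
  have hY : 0 < Real.log Y := Real.log_pos h.one_lt
  rcases h.near ρ' hζ (hd.trans (pow_le_pow_left₀ (by linarith) hlog_le 2)) with h1 | h2
  · exact Or.inl h1
  · exact Or.inr (h2.trans (sub_le_sub_left
      (div_le_div_of_nonneg_right (pow_le_pow_left₀ hloglog_nn hloglog_le 2) hY.le) _))

/-- A half-isolated zero is a zero of `ζ`. [cite: MaynardPratt2024, Definition 9] -/
theorem HalfIsolatedZero.zero {ρ : ℂ} (h : HalfIsolatedZero ρ) : riemannZeta ρ = 0 := by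
  obtain ⟨_, _, _, hY⟩ := h
  exact hY.zero

/-- Definition 9 from Definition 8: a `Y`-half-isolated zero with `Y` in the range
`(log log |γ₀|)³ ≤ log Y ≤ log |γ₀| / log log |γ₀|` is half-isolated.
[cite: MaynardPratt2024, Definition 9] -/
theorem YHalfIsolatedZero.halfIsolatedZero {Y : ℝ} {ρ : ℂ} (h : YHalfIsolatedZero Y ρ)
    (h₁ : Real.log (Real.log ρ.im) ^ 3 ≤ Real.log Y)
    (h₂ : Real.log Y ≤ Real.log ρ.im / Real.log (Real.log ρ.im)) : HalfIsolatedZero ρ :=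
  ⟨Y, h₁, h₂, h⟩

/-! ## The zero-detecting polynomial `S_U(s) = Σ Λ(n) w(n/U) n^{-s}` -/

/-- **The smoothed von Mangoldt sum** `S_U(s) = Σ_n Λ(n) w(n/U) n^{-s}` (Maynard–Pratt §2.1,
p. 5: "`S_Y(s) := Σ_n Λ(n) n^{-s} w(n/Y)`", and `S(U)` in the proof of Proposition 16, p. 10),
for a weight `w : ℝ → ℝ`, a length `U` and a point `s`. Written as a `tsum` over `n : ℕ` of
`Λ(n) · w(n/U) · n^{-s}` (the `n = 0` term vanishes since `Λ(0) = 0`); for `w` vanishing on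
`(b, ∞)` it is a finite sum (`smoothedVonMangoldt_eq_sum`), in general the `tsum` is `0` when the
series is not summable. [cite: MaynardPratt2024, §2.1] -/
def smoothedVonMangoldt (w : ℝ → ℝ) (U : ℝ) (s : ℂ) : ℂ :=
  ∑' n : ℕ, ((vonMangoldt n : ℝ) : ℂ) * ((w ((n : ℝ) / U) : ℝ) : ℂ) * (n : ℂ) ^ (-s)

/-- Unfolding lemma for `smoothedVonMangoldt` (the literal `tsum`). [cite: MaynardPratt2024, §2.1] -/
theorem smoothedVonMangoldt_apply (w : ℝ → ℝ) (U : ℝ) (s : ℂ) :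
    smoothedVonMangoldt w U s =
      ∑' n : ℕ, ((vonMangoldt n : ℝ) : ℂ) * ((w ((n : ℝ) / U) : ℝ) : ℂ) * (n : ℂ) ^ (-s) :=
  rfl

/-- `S_U(s)` is the `L`-series (in Mathlib's sense) of `n ↦ Λ(n) w(n/U)` at `s`. [folklore] -/
theorem smoothedVonMangoldt_eq_LSeries (w : ℝ → ℝ) (U : ℝ) (s : ℂ) :
    smoothedVonMangoldt w U s =
      LSeries (fun n ↦ ((vonMangoldt n : ℝ) : ℂ) * ((w ((n : ℝ) / U) : ℝ) : ℂ)) s := by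
  unfold smoothedVonMangoldt LSeries
  refine tsum_congr fun n ↦ ?_
  rw [LSeries.term_def₀ (by simp)]

/-- The `n`-th term of `S_U(s)` vanishes as soon as `w` vanishes on `(b, ∞)`, `U > 0` and
`n > ⌊bU⌋`. [folklore] -/
theorem smoothedVonMangoldt_term_eq_zero {w : ℝ → ℝ} {b U : ℝ} (hU : 0 < U)
    (hw : ∀ x, b < x → w x = 0) (s : ℂ) {n : ℕ} (hn : ⌊b * U⌋₊ < n) :
    ((vonMangoldt n : ℝ) : ℂ) * ((w ((n : ℝ) / U) : ℝ) : ℂ) * (n : ℂ) ^ (-s) = 0 := by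
  have h1 : b * U < n := Nat.lt_of_floor_lt hn
  have h2 : b < (n : ℝ) / U := by rwa [lt_div_iff₀ hU]
  simp [hw _ h2]

/-- For a weight vanishing on `(b, ∞)` and `U > 0`, `S_U(s)` is the finite sum over
`n ≤ ⌊bU⌋`. [folklore] -/
theorem smoothedVonMangoldt_eq_sum {w : ℝ → ℝ} {b U : ℝ} (hU : 0 < U)
    (hw : ∀ x, b < x → w x = 0) (s : ℂ) :
    smoothedVonMangoldt w U s = ∑ n ∈ Finset.range (⌊b * U⌋₊ + 1),
      ((vonMangoldt n : ℝ) : ℂ) * ((w ((n : ℝ) / U) : ℝ) : ℂ) * (n : ℂ) ^ (-s) := by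
  unfold smoothedVonMangoldt
  refine tsum_eq_sum fun n hn ↦ ?_
  have hn' : ⌊b * U⌋₊ < n := by
    rw [Finset.mem_range, not_lt] at hn
    omega
  exact smoothedVonMangoldt_term_eq_zero hU hw s hn'

/-- For a weight vanishing on `(b, ∞)` and `U > 0`, the series defining `S_U(s)` is summable
(finitely many nonzero terms). [folklore] -/
theorem summable_smoothedVonMangoldt {w : ℝ → ℝ} {b U : ℝ} (hU : 0 < U)
    (hw : ∀ x, b < x → w x = 0) (s : ℂ) :
    Summable fun n : ℕ ↦
      ((vonMangoldt n : ℝ) : ℂ) * ((w ((n : ℝ) / U) : ℝ) : ℂ) * (n : ℂ) ^ (-s) := by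
  refine summable_of_ne_finset_zero (s := Finset.range (⌊b * U⌋₊ + 1)) fun n hn ↦ ?_
  have hn' : ⌊b * U⌋₊ < n := by
    rw [Finset.mem_range, not_lt] at hn
    omega
  exact smoothedVonMangoldt_term_eq_zero hU hw s hn'

/-! ## The weight `w₀` of Lemma 43 -/

namespace MaynardPratt

/-- The function `h` of the proof of Lemma 43 (p. 25): `h(x) = exp(−1/(x(1−x)))` for
`x ∈ (0,1)` and `0` otherwise, written as `expNegInvGlue x · expNegInvGlue (1 − x)` (note
`1/(x(1−x)) = 1/x + 1/(1−x)`; see `w0Core_eq_exp`). [cite: MaynardPratt2024, Lemma 43] -/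
def w0Core (x : ℝ) : ℝ :=
  expNegInvGlue x * expNegInvGlue (1 - x)

/-- `h ≥ 0`. [cite: MaynardPratt2024, Lemma 43] -/
theorem w0Core_nonneg (x : ℝ) : 0 ≤ w0Core x :=
  mul_nonneg (expNegInvGlue.nonneg x) (expNegInvGlue.nonneg _)

/-- `h(x) = 0` for `x ≤ 0`. [cite: MaynardPratt2024, Lemma 43] -/
theorem w0Core_of_nonpos {x : ℝ} (hx : x ≤ 0) : w0Core x = 0 := by
  simp [w0Core, expNegInvGlue.zero_of_nonpos hx]

/-- `h(x) = 0` for `x ≥ 1`. [cite: MaynardPratt2024, Lemma 43] -/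
theorem w0Core_of_one_le {x : ℝ} (hx : 1 ≤ x) : w0Core x = 0 := by
  simp [w0Core, expNegInvGlue.zero_of_nonpos (sub_nonpos.2 hx)]

/-- `h(x) > 0` for `0 < x < 1`. [cite: MaynardPratt2024, Lemma 43] -/
theorem w0Core_pos {x : ℝ} (h0 : 0 < x) (h1 : x < 1) : 0 < w0Core x :=
  mul_pos (expNegInvGlue.pos_of_pos h0) (expNegInvGlue.pos_of_pos (sub_pos.2 h1))

/-- Faithfulness to the printed formula: `h(x) = exp(−1/(x(1−x)))` on `(0,1)`.
[cite: MaynardPratt2024, Lemma 43] -/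
theorem w0Core_eq_exp {x : ℝ} (h0 : 0 < x) (h1 : x < 1) :
    w0Core x = Real.exp (-(1 / (x * (1 - x)))) := by
  have h1' : 0 < 1 - x := sub_pos.2 h1
  have hx0 : x ≠ 0 := h0.ne'
  have hx1 : 1 - x ≠ 0 := h1'.ne'
  simp only [w0Core, expNegInvGlue, not_le.2 h0, not_le.2 h1', if_false, ← Real.exp_add]
  congr 1
  field_simp
  ring

/-- `h` is `C^∞`. [cite: MaynardPratt2024, Lemma 43] -/
theorem contDiff_w0Core {n : ℕ∞} : ContDiff ℝ n w0Core := by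
  unfold w0Core
  fun_prop

/-- `h` is continuous. [cite: MaynardPratt2024, Lemma 43] -/
theorem continuous_w0Core : Continuous w0Core :=
  (contDiff_w0Core (n := 0)).continuous

/-- The normalising constant `C = ∫₀¹ h(x) dx` of Lemma 43. [cite: MaynardPratt2024, Lemma 43] -/
def w0Const : ℝ :=
  ∫ x in (0 : ℝ)..1, w0Core x

/-- `C > 0`. [cite: MaynardPratt2024, Lemma 43] -/
theorem w0Const_pos : 0 < w0Const :=
  intervalIntegral.intervalIntegral_pos_of_pos_on (continuous_w0Core.intervalIntegrable 0 1)
    (fun _ hx ↦ w0Core_pos hx.1 hx.2) zero_lt_one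

/-- `∫₀^y h = 0` for `y ≤ 0`. [cite: MaynardPratt2024, Lemma 43] -/
theorem integral_w0Core_of_nonpos {y : ℝ} (hy : y ≤ 0) : ∫ x in (0 : ℝ)..y, w0Core x = 0 := by
  have : EqOn w0Core (fun _ ↦ (0 : ℝ)) (uIcc 0 y) := by
    intro x hx
    rw [uIcc_of_ge hy] at hx
    exact w0Core_of_nonpos hx.2
  rw [intervalIntegral.integral_congr this]
  simp

/-- `∫₀^y h = C` for `y ≥ 1`. [cite: MaynardPratt2024, Lemma 43] -/
theorem integral_w0Core_of_one_le {y : ℝ} (hy : 1 ≤ y) :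
    ∫ x in (0 : ℝ)..y, w0Core x = w0Const := by
  have h1 : ∫ x in (1 : ℝ)..y, w0Core x = 0 := by
    have : EqOn w0Core (fun _ ↦ (0 : ℝ)) (uIcc 1 y) := by
      intro x hx
      rw [uIcc_of_le hy] at hx
      exact w0Core_of_one_le hx.1
    rw [intervalIntegral.integral_congr this]
    simp
  rw [← intervalIntegral.integral_add_adjacent_intervals (continuous_w0Core.intervalIntegrable 0 1)
    (continuous_w0Core.intervalIntegrable 1 y), h1, add_zero]
  rfl

/-- The function `H(y) = C⁻¹ ∫_{−∞}^y h(x) dx` of the proof of Lemma 43 (p. 25); since `h`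
vanishes off `(0,1)` we write the integral as `∫₀^y`. [cite: MaynardPratt2024, Lemma 43] -/
def w0Step (y : ℝ) : ℝ :=
  (∫ x in (0 : ℝ)..y, w0Core x) / w0Const

/-- `H(y) = 0` for `y ≤ 0`. [cite: MaynardPratt2024, Lemma 43] -/
theorem w0Step_of_nonpos {y : ℝ} (hy : y ≤ 0) : w0Step y = 0 := by
  simp [w0Step, integral_w0Core_of_nonpos hy]

/-- `H(y) = 1` for `y ≥ 1`. [cite: MaynardPratt2024, Lemma 43] -/
theorem w0Step_of_one_le {y : ℝ} (hy : 1 ≤ y) : w0Step y = 1 := by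
  rw [w0Step, integral_w0Core_of_one_le hy, div_self w0Const_pos.ne']

/-- `H(0) = 0`. [cite: MaynardPratt2024, Lemma 43] -/
@[simp] theorem w0Step_zero : w0Step 0 = 0 := w0Step_of_nonpos le_rfl

/-- `H(1) = 1`. [cite: MaynardPratt2024, Lemma 43] -/
@[simp] theorem w0Step_one : w0Step 1 = 1 := w0Step_of_one_le le_rfl

/-- `H` is monotone (its derivative `h/C` is nonnegative). [cite: MaynardPratt2024, Lemma 43] -/
theorem monotone_w0Step : Monotone w0Step := by
  intro y₁ y₂ h
  unfold w0Step
  refine div_le_div_of_nonneg_right ?_ w0Const_pos.le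
  have hadd : (∫ x in (0 : ℝ)..y₁, w0Core x) + ∫ x in y₁..y₂, w0Core x
      = ∫ x in (0 : ℝ)..y₂, w0Core x :=
    intervalIntegral.integral_add_adjacent_intervals
      (continuous_w0Core.intervalIntegrable 0 y₁) (continuous_w0Core.intervalIntegrable y₁ y₂)
  have hnn : 0 ≤ ∫ x in y₁..y₂, w0Core x :=
    intervalIntegral.integral_nonneg h fun u _ ↦ w0Core_nonneg u
  linarith

/-- `0 ≤ H`. [cite: MaynardPratt2024, Lemma 43] -/
theorem w0Step_nonneg (y : ℝ) : 0 ≤ w0Step y := by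
  rcases le_or_gt y 0 with hy | hy
  · rw [w0Step_of_nonpos hy]
  · simpa using monotone_w0Step hy.le

/-- `H ≤ 1`. [cite: MaynardPratt2024, Lemma 43] -/
theorem w0Step_le_one (y : ℝ) : w0Step y ≤ 1 := by
  rcases le_or_gt 1 y with hy | hy
  · rw [w0Step_of_one_le hy]
  · simpa using monotone_w0Step hy.le

/-- `d/dy ∫₀^y h = h(y)`. [folklore] -/
theorem hasDerivAt_integral_w0Core (y : ℝ) :
    HasDerivAt (fun u ↦ ∫ x in (0 : ℝ)..u, w0Core x) (w0Core y) y :=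
  intervalIntegral.integral_hasDerivAt_right (continuous_w0Core.intervalIntegrable 0 y)
    (continuous_w0Core.stronglyMeasurableAtFilter _ _) continuous_w0Core.continuousAt

/-- `H' = h / C`. [cite: MaynardPratt2024, Lemma 43] -/
theorem hasDerivAt_w0Step (y : ℝ) : HasDerivAt w0Step (w0Core y / w0Const) y :=
  (hasDerivAt_integral_w0Core y).div_const w0Const

/-- `H' = h / C` as an equation for `deriv`. [cite: MaynardPratt2024, Lemma 43] -/
theorem deriv_w0Step : deriv w0Step = fun y ↦ w0Core y / w0Const :=
  funext fun y ↦ (hasDerivAt_w0Step y).deriv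

/-- `H` is differentiable. [cite: MaynardPratt2024, Lemma 43] -/
theorem differentiable_w0Step : Differentiable ℝ w0Step :=
  fun y ↦ (hasDerivAt_w0Step y).differentiableAt

/-- `H` is `C^∞`. [cite: MaynardPratt2024, Lemma 43] -/
theorem contDiff_w0Step {n : ℕ∞} : ContDiff ℝ n w0Step := by
  have h : ContDiff ℝ ((⊤ : ℕ∞) : WithTop ℕ∞) w0Step := by
    rw [contDiff_infty_iff_deriv, deriv_w0Step]
    exact ⟨differentiable_w0Step, contDiff_w0Core.div_const _⟩
  exact h.of_le (by exact_mod_cast le_top)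

/-- **The weight `w₀` of Lemma 43** (Maynard–Pratt, p. 25): `w₀(x) = H(2x − 1) − H(x − 1)`,
a nonnegative `C^∞` function bounded by `1`, supported in `[1/2, 2]`, with `w₀(1) = 1` and
`Σ_{m ≥ 0} w₀(x/2^m) = 1` for `x ≥ 1` (`hasSum_w0_div_two_pow`), and (not proved here)
`W₀(0) = log 2`, `|W₀(σ+it)| ≪ 2^{|σ|} e^{−√(|t|/2)}` for its Mellin transform `W₀`. This is the
`w₀` of Theorem 4 and Proposition 16. [cite: MaynardPratt2024, Lemma 43] -/
def w0 (x : ℝ) : ℝ :=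
  w0Step (2 * x - 1) - w0Step (x - 1)

/-- `w₀(x) = 0` for `x ≤ 1/2`. [cite: MaynardPratt2024, Lemma 43] -/
theorem w0_of_le_half {x : ℝ} (hx : x ≤ 1 / 2) : w0 x = 0 := by
  have h1 : 2 * x - 1 ≤ 0 := by linarith
  have h2 : x - 1 ≤ 0 := by linarith
  simp [w0, w0Step_of_nonpos h1, w0Step_of_nonpos h2]

/-- `w₀(x) = 0` for `x ≥ 2`. [cite: MaynardPratt2024, Lemma 43] -/
theorem w0_of_two_le {x : ℝ} (hx : 2 ≤ x) : w0 x = 0 := by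
  have h1 : 1 ≤ 2 * x - 1 := by linarith
  have h2 : 1 ≤ x - 1 := by linarith
  simp [w0, w0Step_of_one_le h1, w0Step_of_one_le h2]

/-- `w₀(1) = H(1) − H(0) = 1`. [cite: MaynardPratt2024, Lemma 43] -/
@[simp] theorem w0_one : w0 1 = 1 := by
  norm_num [w0]

/-- `w₀ ≥ 0` (`H` is monotone and `x − 1 ≤ 2x − 1` for `x ≥ 0`). [cite: MaynardPratt2024, Lemma 43] -/
theorem w0_nonneg (x : ℝ) : 0 ≤ w0 x := by
  rcases le_or_gt x 0 with hx | hx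
  · rw [w0_of_le_half (hx.trans (by norm_num))]
  · have : x - 1 ≤ 2 * x - 1 := by linarith
    exact sub_nonneg.2 (monotone_w0Step this)

/-- `w₀ ≤ 1` ("bounded by 1"). [cite: MaynardPratt2024, Lemma 43] -/
theorem w0_le_one (x : ℝ) : w0 x ≤ 1 := by
  have h1 := w0Step_le_one (2 * x - 1)
  have h2 := w0Step_nonneg (x - 1)
  unfold w0
  linarith

/-- `w₀` is supported in `[1/2, 2]`. [cite: MaynardPratt2024, Lemma 43] -/
theorem support_w0_subset : Function.support w0 ⊆ Icc (1 / 2) 2 := by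
  intro x hx
  rw [Function.mem_support] at hx
  by_contra h
  rw [mem_Icc, not_and_or, not_le, not_le] at h
  rcases h with h | h
  · exact hx (w0_of_le_half h.le)
  · exact hx (w0_of_two_le h.le)

/-- `w₀` vanishes on `(2, ∞)` (the form consumed by `smoothedVonMangoldt_eq_sum`).
[cite: MaynardPratt2024, Lemma 43] -/
theorem w0_eq_zero_of_two_lt (x : ℝ) (hx : 2 < x) : w0 x = 0 :=
  w0_of_two_le hx.le

/-- `w₀` is `C^∞`. [cite: MaynardPratt2024, Lemma 43] -/
theorem contDiff_w0 {n : ℕ∞} : ContDiff ℝ n w0 := by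
  have h1 : ContDiff ℝ n (fun x : ℝ ↦ 2 * x - 1) := by fun_prop
  have h2 : ContDiff ℝ n (fun x : ℝ ↦ x - 1) := by fun_prop
  exact (contDiff_w0Step.comp h1).sub (contDiff_w0Step.comp h2)

/-- `w₀` is continuous. [cite: MaynardPratt2024, Lemma 43] -/
theorem continuous_w0 : Continuous w0 :=
  (contDiff_w0 (n := 0)).continuous

/-- The dyadic partition of unity of Lemma 43: `Σ_{m ≥ 0} w₀(x/2^m) = 1` for `x ≥ 1` ("an
exercise in telescoping series": `w₀(x/2^m) = H(2x/2^m − 1) − H(2x/2^{m+1} − 1)`, and only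
finitely many terms are nonzero). [cite: MaynardPratt2024, Lemma 43] -/
theorem hasSum_w0_div_two_pow {x : ℝ} (hx : 1 ≤ x) :
    HasSum (fun m : ℕ ↦ w0 (x / 2 ^ m)) 1 := by
  obtain ⟨M, hM⟩ : ∃ M : ℕ, x < 2 ^ M := pow_unbounded_of_one_lt x one_lt_two
  have hzero : ∀ m ∉ Finset.range (M + 1), w0 (x / 2 ^ m) = 0 := by
    intro m hm
    rw [Finset.mem_range, not_lt] at hm
    apply w0_of_le_half
    have h2 : (2 : ℝ) ^ (M + 1) ≤ 2 ^ m := pow_le_pow_right₀ one_le_two hm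
    have h3 : 2 * x ≤ 2 ^ m := by
      rw [pow_succ] at h2
      linarith
    rw [div_le_iff₀ (by positivity : (0 : ℝ) < 2 ^ m)]
    linarith
  have hsum : HasSum (fun m : ℕ ↦ w0 (x / 2 ^ m))
      (∑ m ∈ Finset.range (M + 1), w0 (x / 2 ^ m)) :=
    hasSum_sum_of_ne_finset_zero hzero
  convert hsum using 1
  have htel : ∀ m : ℕ, w0 (x / 2 ^ m) =
      w0Step (2 * x / 2 ^ m - 1) - w0Step (2 * x / 2 ^ (m + 1) - 1) := by
    intro m
    have e1 : 2 * (x / 2 ^ m) - 1 = 2 * x / 2 ^ m - 1 := by ring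
    have e2 : x / 2 ^ m - 1 = 2 * x / 2 ^ (m + 1) - 1 := by ring
    rw [w0, e1, e2]
  simp_rw [htel]
  rw [Finset.sum_range_sub']
  have hA : w0Step (2 * x / 2 ^ 0 - 1) = 1 := w0Step_of_one_le (by norm_num; linarith)
  have hB : w0Step (2 * x / 2 ^ (M + 1) - 1) = 0 := w0Step_of_nonpos (by
    rw [sub_nonpos, div_le_one (by positivity), pow_succ]
    linarith)
  rw [hA, hB]
  norm_num

/-- `Σ'_{m ≥ 0} w₀(x/2^m) = 1` for `x ≥ 1`. [cite: MaynardPratt2024, Lemma 43] -/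
theorem tsum_w0_div_two_pow {x : ℝ} (hx : 1 ≤ x) : ∑' m : ℕ, w0 (x / 2 ^ m) = 1 :=
  (hasSum_w0_div_two_pow hx).tsum_eq

/-- `w₀` is an admissible bump in the sense used by route statements about `S_U`:
`C^∞`, nonnegative, supported in `[1/2, 2]`, `w₀(1) = 1`. [cite: MaynardPratt2024, Lemma 43] -/
theorem w0_admissible :
    ContDiff ℝ ((⊤ : ℕ∞) : WithTop ℕ∞) w0 ∧ (∀ x, 0 ≤ w0 x) ∧
      Function.support w0 ⊆ Icc (1 / 2) 2 ∧ w0 1 = 1 :=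
  ⟨contDiff_w0, w0_nonneg, support_w0_subset, w0_one⟩

/-- `S_U(s)` with the weight `w₀` is a finite sum over `n ≤ 2U` (for `U > 0`).
[cite: MaynardPratt2024, Proposition 16 (proof)] -/
theorem smoothedVonMangoldt_w0_eq_sum {U : ℝ} (hU : 0 < U) (s : ℂ) :
    smoothedVonMangoldt w0 U s = ∑ n ∈ Finset.range (⌊2 * U⌋₊ + 1),
      ((vonMangoldt n : ℝ) : ℂ) * ((w0 ((n : ℝ) / U) : ℝ) : ℂ) * (n : ℂ) ^ (-s) :=
  smoothedVonMangoldt_eq_sum hU w0_eq_zero_of_two_lt s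

end MaynardPratt

/-! ## Proposition 16 as a named fact -/

/-- **Maynard–Pratt 2024, Proposition 16** (short zero-detecting polynomial for `Y`-half-isolated
zeros; p. 10 of arXiv:2206.11729), NAMED FACT. As printed: for `T` sufficiently large there is a
set `𝒰 = 𝒰(T) ⊆ [exp((log log T)³), T²]` with `#𝒰 ≤ (log T)^{152}` such that, with `w₀` the
function of Lemma 43 (`MaynardPratt.w0`) and `(log log T)³ ≤ log Y ≤ log T`, every
`Y`-half-isolated zero `ρ₀ = β₀ + iγ₀` with `γ₀ ∈ [T, 2T]` admits `U ∈ 𝒰 ∩ [Y, Y²]` with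
`|Σ_n Λ(n) n^{-ρ₀} w₀(n/U)| ≫ (log T)^{-100}` (absolute implied constant, here `c > 0`).

Vendored with two extra restrictions, so that the printed statement IMPLIES this one:
* `1/2 ≤ Re ρ₀` — assumed in the first line of the printed proof (p. 10, "Let `ρ₀ = β₀ + iγ₀` be
  a `Y`-half-isolated zero of `ζ(s)` with `γ₀ ∈ [T,2T]` and `β₀ ≥ 1/2`");
* `log Y ≤ (log T)/2` instead of `log Y ≤ log T` — the printed proof (p. 10) discards the zeros
  `ρ` with `|ρ − ρ₀| > (log T)²/2` from `−Σ_ρ U^{ρ−ρ₀} W₀(ρ − ρ₀)` using only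
  `W₀(ρ − ρ₀) ≪ T^{-1/100} |ρ − ρ₀|^{-2}`; for zeros outside the window `(log |γ₀|)²` of
  Definition 8 the factor `|U^{ρ−ρ₀}| ≤ U^{1−β₀} ≤ U^{1/2}` is controlled by nothing else, and
  Lemma 43 gives `|W₀(ρ − ρ₀)| ≪ e^{−(log T)/√2} = T^{−0.707…}` there, so the discarded terms are
  `≪ U^{1/2} T^{−0.707} (log T)²`: this is `o((log T)^{-200})` when `U ≤ Y² ≤ T`, i.e. in the
  range kept here, which contains every use of the proposition in the paper (Theorem 4, i.e.
  half-isolated zeros of Definition 9, `log Y ≤ log |γ₀| / log log |γ₀|`; Lemma 35: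
  `Y = A^{1/2} ≤ T^{1/2}`), whereas for `U` close to `T²` (allowed by the printed range) the
  same bound is `T^{0.29…}` and the printed argument does not cover it.
In Lean: `c / (log T)^100 ≤ ‖smoothedVonMangoldt MaynardPratt.w0 U ρ‖` with an absolute `c > 0`.
Discharging this fact = formalising pp. 8–11 and Lemma 43 of the paper.
[cite: MaynardPratt2024, Proposition 16] -/
def MaynardPratt2024_prop16 : Prop :=
  ∃ c : ℝ, 0 < c ∧ ∃ T₀ : ℝ, ∀ T : ℝ, T₀ ≤ T →
    ∃ 𝒰 : Finset ℝ, (𝒰.card : ℝ) ≤ Real.log T ^ 152 ∧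
      (∀ U ∈ 𝒰, Real.exp (Real.log (Real.log T) ^ 3) ≤ U ∧ U ≤ T ^ 2) ∧
      ∀ Y : ℝ, Real.log (Real.log T) ^ 3 ≤ Real.log Y → Real.log Y ≤ Real.log T / 2 →
        ∀ ρ : ℂ, YHalfIsolatedZero Y ρ → 1 / 2 ≤ ρ.re → T ≤ ρ.im → ρ.im ≤ 2 * T →
          ∃ U ∈ 𝒰, Y ≤ U ∧ U ≤ Y ^ 2 ∧
            c / Real.log T ^ 100 ≤ ‖smoothedVonMangoldt MaynardPratt.w0 U ρ‖

/-- Corollary of `MaynardPratt2024_prop16` in the currency of a negative power of `log T` (the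
form used by route statements): the implied constant is absorbed into the exponent, `C = 101`,
and the finite set `𝒰` is forgotten (`U ∈ [Y, Y²]`). [cite: MaynardPratt2024, Proposition 16] -/
theorem MaynardPratt2024_prop16.detection (h : MaynardPratt2024_prop16) :
    ∃ C : ℝ, 1 ≤ C ∧ ∃ T₀ : ℝ, ∀ T : ℝ, T₀ ≤ T →
      ∀ Y : ℝ, Real.log (Real.log T) ^ 3 ≤ Real.log Y → Real.log Y ≤ Real.log T / 2 →
        ∀ ρ : ℂ, YHalfIsolatedZero Y ρ → 1 / 2 ≤ ρ.re → T ≤ ρ.im → ρ.im ≤ 2 * T →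
          ∃ U : ℝ, Y ≤ U ∧ U ≤ Y ^ 2 ∧
            Real.log T ^ (-C) ≤ ‖smoothedVonMangoldt MaynardPratt.w0 U ρ‖ := by
  obtain ⟨c, hc, T₀, hT⟩ := h
  refine ⟨101, by norm_num, max T₀ (Real.exp (max 1 (1 / c))), ?_⟩
  intro T hTge Y hY₁ hY₂ ρ hρ hre him₁ him₂
  have hT₀ : T₀ ≤ T := (le_max_left _ _).trans hTge
  have hexp : Real.exp (max 1 (1 / c)) ≤ T := (le_max_right _ _).trans hTge
  have hTpos : 0 < T := (Real.exp_pos _).trans_le hexp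
  have hlog : max 1 (1 / c) ≤ Real.log T := by
    rwa [Real.le_log_iff_exp_le hTpos]
  have hlog₁ : 1 ≤ Real.log T := (le_max_left _ _).trans hlog
  have hlogc : 1 / c ≤ Real.log T := (le_max_right _ _).trans hlog
  have hL : 0 < Real.log T := by linarith
  obtain ⟨𝒰, -, -, hdet⟩ := hT T hT₀
  obtain ⟨U, -, hYU, hUY, hS⟩ := hdet Y hY₁ hY₂ ρ hρ hre him₁ him₂
  refine ⟨U, hYU, hUY, le_trans ?_ hS⟩
  have hcl : 1 ≤ c * Real.log T := by
    rw [div_le_iff₀ hc] at hlogc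
    linarith
  have h1 : Real.log T ^ (-(101 : ℝ)) = 1 / (Real.log T ^ 100 * Real.log T) := by
    rw [Real.rpow_neg hL.le, ← pow_succ, one_div,
      show (101 : ℝ) = ((101 : ℕ) : ℝ) by norm_num, Real.rpow_natCast]
  rw [h1, div_le_div_iff₀ (mul_pos (pow_pos hL _) hL) (pow_pos hL _), one_mul]
  calc Real.log T ^ 100 = Real.log T ^ 100 * 1 := (mul_one _).symm
    _ ≤ Real.log T ^ 100 * (c * Real.log T) := by gcongr
    _ = c * (Real.log T ^ 100 * Real.log T) := by ring


/-! ## Theorem 4 from Proposition 16 -/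

/-- **Maynard–Pratt 2024, Theorem 4** (half-isolated zeros have short zero-detecting polynomials;
p. 4 of arXiv:2206.11729), DERIVED from the named fact `MaynardPratt2024_prop16` exactly as on
p. 11: "Theorem 4 is a consequence of Proposition 16, since every half-isolated zero with ordinate
in `[T, 2T]` is `Y`-half-isolated for some `Y ∈ [exp((log log T)³), T^{2/log log T}]`."
As printed: there are an absolute constant `C ≥ 1` and a fixed non-negative smooth `w₀` supported
in `[1/2, 2]` (here `MaynardPratt.w0`, see `MaynardPratt.w0_admissible`) such that every
half-isolated zero `ρ₀ = β₀ + iγ₀` (Definition 9, `HalfIsolatedZero`) with `γ₀ ∈ [T, 2T]` admits a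
real `Y ∈ [T^{(log log T)³ / log T}, T^{5 / log log T}]` with
`|Σ_n Λ(n) n^{-ρ₀} w₀(n/Y)| ≥ (log T)^{-C}`.
Deviations, both inherited from `MaynardPratt2024_prop16` and both making the statement weaker than
the printed one: `T ≥ T₀` is explicit ("`T` sufficiently large" is implicit in print), and
`β₀ ≥ 1/2` (first line of the printed proof of Proposition 16). The range bookkeeping: from
`(log log γ₀)³ ≤ log Y ≤ log γ₀ / log log γ₀` and `T ≤ γ₀ ≤ 2T` one gets
`(log log T)³ ≤ log Y ≤ 2 log T / log log T ≤ (log T)/2` once `log log T ≥ 4`, and the detecting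
length `U ∈ [Y, Y²]` of Proposition 16 lies in `[exp((log log T)³), exp(4 log T / log log T)]`.
[cite: MaynardPratt2024, Theorem 4] -/
theorem MaynardPratt2024_prop16.theorem4 (h : MaynardPratt2024_prop16) :
    ∃ C : ℝ, 1 ≤ C ∧ ∃ T₀ : ℝ, ∀ T : ℝ, T₀ ≤ T →
      ∀ ρ : ℂ, HalfIsolatedZero ρ → 1 / 2 ≤ ρ.re → T ≤ ρ.im → ρ.im ≤ 2 * T →
        ∃ Y : ℝ, T ^ (Real.log (Real.log T) ^ 3 / Real.log T) ≤ Y ∧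
          Y ≤ T ^ (5 / Real.log (Real.log T)) ∧
            Real.log T ^ (-C) ≤ ‖smoothedVonMangoldt MaynardPratt.w0 Y ρ‖ := by
  obtain ⟨C, hC, T₀, hT⟩ := h.detection
  refine ⟨C, hC, max T₀ (Real.exp (Real.exp 4)), ?_⟩
  intro T hTge ρ hρ hre him₁ him₂
  have hT₀ : T₀ ≤ T := (le_max_left _ _).trans hTge
  have hTe : Real.exp (Real.exp 4) ≤ T := (le_max_right _ _).trans hTge
  have hTpos : 0 < T := (Real.exp_pos _).trans_le hTe
  have hlogT : Real.exp 4 ≤ Real.log T := by rwa [Real.le_log_iff_exp_le hTpos]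
  have he4 : (4 : ℝ) + 1 ≤ Real.exp 4 := Real.add_one_le_exp 4
  have hlogT4 : (5 : ℝ) ≤ Real.log T := by linarith
  have hlogTpos : 0 < Real.log T := by linarith
  have hll : 4 ≤ Real.log (Real.log T) := by rwa [Real.le_log_iff_exp_le hlogTpos]
  have hllpos : 0 < Real.log (Real.log T) := by linarith
  -- `γ₀ = ρ.im` versus `T`
  have hγpos : 0 < ρ.im := hTpos.trans_le him₁
  have hlogγ : Real.log T ≤ Real.log ρ.im := Real.log_le_log hTpos him₁
  have hllγ : Real.log (Real.log T) ≤ Real.log (Real.log ρ.im) := Real.log_le_log hlogTpos hlogγ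
  have h2T : Real.log ρ.im ≤ Real.log 2 + Real.log T := by
    rw [← Real.log_mul two_ne_zero hTpos.ne']
    exact Real.log_le_log hγpos him₂
  have hlog2 : Real.log 2 ≤ Real.log T :=
    Real.log_le_log two_pos (by linarith [Real.add_one_le_exp (Real.exp 4)])
  have hlogγ₂ : Real.log ρ.im ≤ 2 * Real.log T := by linarith
  -- the `Y` of Definition 9
  obtain ⟨Y, hY₁, hY₂, hYρ⟩ := hρ
  have hYpos : 0 < Y := zero_lt_one.trans hYρ.one_lt
  have hr₁ : Real.log (Real.log T) ^ 3 ≤ Real.log Y :=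
    (pow_le_pow_left₀ hllpos.le hllγ 3).trans hY₁
  have hY₃ : Real.log Y ≤ 2 * Real.log T / Real.log (Real.log T) :=
    hY₂.trans (div_le_div₀ (by linarith) hlogγ₂ hllpos hllγ)
  have hr₂ : Real.log Y ≤ Real.log T / 2 := by
    refine hY₃.trans ?_
    rw [div_le_div_iff₀ hllpos two_pos]
    nlinarith
  obtain ⟨U, hYU, hUY, hS⟩ := hT T hT₀ Y hr₁ hr₂ ρ hYρ hre him₁ him₂
  refine ⟨U, ?_, ?_, hS⟩
  · -- `T^{(log log T)³ / log T} = exp((log log T)³) ≤ Y ≤ U`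
    rw [Real.rpow_def_of_pos hTpos, mul_div_cancel₀ _ hlogTpos.ne']
    calc Real.exp (Real.log (Real.log T) ^ 3) ≤ Real.exp (Real.log Y) := Real.exp_le_exp.2 hr₁
      _ = Y := Real.exp_log hYpos
      _ ≤ U := hYU
  · -- `U ≤ Y² = exp(2 log Y) ≤ exp(4 log T / log log T) ≤ T^{5 / log log T}`
    rw [Real.rpow_def_of_pos hTpos]
    calc U ≤ Y ^ 2 := hUY
      _ = Real.exp (2 * Real.log Y) := by
          rw [← Real.exp_log (pow_pos hYpos 2), Real.log_pow]
          norm_num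
      _ ≤ Real.exp (Real.log T * (5 / Real.log (Real.log T))) := by
          refine Real.exp_le_exp.2 ?_
          rw [mul_div_assoc', le_div_iff₀ hllpos]
          rw [le_div_iff₀ hllpos] at hY₃
          nlinarith


/-! ## The definitional blind spot: a zero below (and not to the left) defeats half-isolation

Maynard–Pratt name vertical arithmetic progressions of zeros as the obstruction to their method
("if the zeros in the neighbourhood of `ρ₀` are approximately in a vertical arithmetic progression
… then `S_Y(ρ₀)` is small for all choices of smooth `w` and `Y < T^{1/c−ε}`", p. 5; "bows", §8 of
arXiv:2206.11729). The two lemmas below record only the DEFINITIONAL half of that remark, which is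
immediate from Definition 8: a `Y`-half-isolated zero has no zero of `ζ` below it and not to its
left inside the window `(log γ₀)²`; hence in a vertical arithmetic progression of zeros with common
difference at most `(log γ)²` no member other than the bottom one is half-isolated, so Proposition 16
/ Theorem 4 (`MaynardPratt2024_prop16_holds`, `MaynardPratt2024_prop16.theorem4`) say nothing about
such zeros. The ANALYTIC half of the remark (uniform smallness of the detecting polynomial on such
configurations, cf. Remark 13) is a printed remark, not a theorem, and is not asserted here. -/

/-- **No zero below and not to the left of a `Y`-half-isolated zero** (immediate from
Maynard–Pratt Definition 8, p. 8 of arXiv:2206.11729): if `ρ` is `Y`-half-isolated,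
`log log (Im ρ) ≠ 0` (so that the offset `(log log γ₀)²/log Y` of the second alternative is
positive; it fails only when `log |Im ρ| ∈ {0, 1, −1}`, i.e. never for `|Im ρ| > e`),
and `ρ'` is a zero of `ζ` with `‖ρ' − ρ‖ ≤ (log Im ρ)²` and `Re ρ ≤ Re ρ'`, then `Im ρ ≤ Im ρ'`:
every such zero lies ABOVE `ρ`. [cite: MaynardPratt2024, Definition 8] -/
theorem YHalfIsolatedZero.im_le_of_re_le {Y : ℝ} {ρ : ℂ} (h : YHalfIsolatedZero Y ρ)
    (hγ : Real.log (Real.log ρ.im) ≠ 0) {ρ' : ℂ} (hζ : riemannZeta ρ' = 0)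
    (hd : ‖ρ' - ρ‖ ≤ Real.log ρ.im ^ 2) (hre : ρ.re ≤ ρ'.re) : ρ.im ≤ ρ'.im := by
  rcases h.near ρ' hζ hd with ⟨-, him⟩ | hleft
  · exact him
  · exfalso
    have hY : 0 < Real.log Y := Real.log_pos h.one_lt
    have hpos : 0 < Real.log (Real.log ρ.im) ^ 2 / Real.log Y :=
      div_pos (by positivity) hY
    linarith

/-- Negative form of `YHalfIsolatedZero.im_le_of_re_le`: a `Y`-half-isolated zero `ρ` (with
`log log (Im ρ) ≠ 0`) has NO zero of `ζ` strictly below it and not to its left inside the window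
`(log Im ρ)²`. [cite: MaynardPratt2024, Definition 8] -/
theorem YHalfIsolatedZero.no_zero_below {Y : ℝ} {ρ : ℂ} (h : YHalfIsolatedZero Y ρ)
    (hγ : Real.log (Real.log ρ.im) ≠ 0) {ρ' : ℂ} (hζ : riemannZeta ρ' = 0)
    (hd : ‖ρ' - ρ‖ ≤ Real.log ρ.im ^ 2) (hre : ρ.re ≤ ρ'.re) : ¬ ρ'.im < ρ.im :=
  not_lt.mpr (h.im_le_of_re_le hγ hζ hd hre)

/-- **A zero of `ζ` with another zero vertically below it is not half-isolated** (Definition 9;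
the picket-fence case of the "vertical arithmetic progressions" obstruction, pp. 5 and 20 of
arXiv:2206.11729, in its definitional form): if `ρ'` is a zero of `ζ` with `Re ρ ≤ Re ρ'`,
`Im ρ' < Im ρ` and `‖ρ' − ρ‖ ≤ (log Im ρ)²`, and `log log (Im ρ) ≠ 0`, then `ρ` is not
half-isolated. In particular, in a vertical arithmetic progression of zeros of `ζ` at height `γ`
with common difference `≤ (log γ)²`, only the bottom zero can be half-isolated.
[cite: MaynardPratt2024, Definition 9] -/
theorem not_halfIsolatedZero_of_zero_below {ρ ρ' : ℂ} (hγ : Real.log (Real.log ρ.im) ≠ 0)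
    (hζ : riemannZeta ρ' = 0) (hre : ρ.re ≤ ρ'.re) (him : ρ'.im < ρ.im)
    (hd : ‖ρ' - ρ‖ ≤ Real.log ρ.im ^ 2) : ¬ HalfIsolatedZero ρ := by
  rintro ⟨Y, -, -, hY⟩
  exact not_lt.mpr (hY.im_le_of_re_le hγ hζ hd hre) him

end Literature.NumberTheory.LFunctions
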